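import Literature.MathematicalPhysics.QuantumLattice.LatticeGaugeDLR
import HarnessLib

/-!
# First-order transition of the nonlinear plaquette action (van Enter–Shlosman 2005, Theorem 2)

A NAMED FACT (D-0014; unproved here): van Enter and Shlosman, *Provable first-order transitions for nonlinear
vector and gauge models with continuous symmetries*, Commun. Math. Phys. **255** (2005) 21–32
(doi:10.1007/s00220-004-1286-1, arXiv:cond-mat/0306362), Theorem 2: "For lattice gauge models with plaquette
action `((1 + L(U_P))/2)^p`, (where `L(U_P) = Tr(U_P + U_P^*)`) in dimension 3 and more and `p` high enough,
there is a first order transition, that is there exists a temperature at which the free energy is not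
differentiable in the temperature parameter."  The variables are "elements of a unitary representation of a
compact continuous gauge group, e.g. `U(1)`, `SU(n)`, or sums thereof"; the proof (reflection positivity and
chessboard/contour estimates of Kotecký–Shlosman type, with the ordered/disordered plaquette dichotomy of a
deep narrow well of width `ε = O(p^{-1/2})`) is sketched there for `U(1)`, `d = 3`.

## Rendering (special case `G = SU(2)`, `d = 4`, the tree's torus free energy density)

* The plaquette variable is normalised to `w(U) = (1 + Re tr U / 2)/2 ∈ [0, 1]` (`= 1` iff `U = 1`, quadratic
  maximum), the reading under which `w^p` is the "deep and narrow well" of the paper (its displayed `U(1)`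
  Hamiltonian is `-J Σ_P ((1 + cos φ_P)/2)^p`); literally `(1 + Tr(U + U^*))/2 ∉ [0, 1]` for `SU(2)`.
* The model with Gibbs weight `exp(J Σ_P w(U_P)^p)` (product Haar reference measure) is, up to the smooth factor
  `exp(-6 · 8^p x)` per site, the WILSON theory `exp(-x Σ_P (N - Re tr ρ(U_P)))` of ANY continuous matrix
  representation `ρ` of `SU(2)` whose Wilson action is `N - Re tr ρ(U) = 8^p (1 - w(U)^p)` (one exists for every
  `p ≥ 1`: the Kronecker power `(4·𝟙 ⊕ V ⊕ V̄)^{⊗p}`, `N = 8^p`, landed summit-side as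
  `Summit.QuantumFields.YangMills.Theorems.TubeZeroFreeChannel.stub_vesRep`), at `J = 8^p x`; so the paper's free
  energy in `J` and the tree's torus free energy density `x ↦ freeEnergyDensity 4 ρ x` (`LatticeGaugeDLR`; it exists,
  `exists_hasFreeEnergyDensity_holds`, and is boundary-condition independent, `tendsto_freeEnergyPerSite_halfOpenBox`)
  differ by the affine map `x ↦ -6 · 8^p x + f_vES(8^p x)`: non-differentiability at `J_t > 0` is
  non-differentiability at `x₁ = J_t / 8^p > 0`.
* Deliberately NOT here: `d = 3`, other groups, the `RP^{N-1}` Theorem 1, any value of `p₀`, the latent heat.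

Consumed by the `QuantumFields/YangMills` crux dossier `TubeZeroFreeChannel` (route `ComplexCouplingChannel`): it is
verbatim the registered stub `stub_vesFreeEnergyNotDifferentiable` of line `legendre-capped-pocket` and, with the landed
tube-rate lemmas, gives a free-energy WALL on the real coupling axis at an admissible `(G, r)`, which makes
`Summit.QuantumFields.YangMills.Theorems.TubeZeroFreeChannel.Negative.not_stripChannel_of_wall` unconditional.
-/

namespace Literature.MathematicalPhysics.QuantumLattice

/-- **van Enter–Shlosman, first-order transition of the nonlinear plaquette action** (CMP 255 (2005), Theorem 2;
special case `G = SU(2)`, `d = 4`, normalised plaquette variable `w(U) = (1 + Re tr U/2)/2`, free energy = the torus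
free energy density `freeEnergyDensity 4 ρ` of the equivalent Wilson theory): there is `p₀` such that for every
`p ≥ p₀` and every continuous matrix representation `ρ` of `SU(2)` with Wilson action
`N - Re tr ρ(U) = 8^p (1 - ((1 + Re tr U/2)/2)^p)`, the free energy density `x ↦ freeEnergyDensity 4 ρ x` is NOT
differentiable at some coupling `x₁ > 0`.
-- TODO(general form): every compact gauge group with a unitary representation, every dimension `d ≥ 3`.
[cite: VanEnterShlosman2005, Thm 2] -/
def vanEnterShlosman_firstOrder : Prop :=
  ∃ p₀ : ℕ, ∀ p : ℕ, p₀ ≤ p →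
    ∀ (N : ℕ) (ρ : Matrix.specialUnitaryGroup (Fin 2) ℂ →* Matrix (Fin N) (Fin N) ℂ), Continuous ρ →
      (∀ U : Matrix.specialUnitaryGroup (Fin 2) ℂ,
        (N : ℝ) - (ρ U).trace.re =
          (8 : ℝ) ^ p * (1 - ((1 + (U : Matrix (Fin 2) (Fin 2) ℂ).trace.re / 2) / 2) ^ p)) →
      ∃ x₁ : ℝ, 0 < x₁ ∧ ¬ DifferentiableAt ℝ (fun x : ℝ => freeEnergyDensity 4 ρ x) x₁

end Literature.MathematicalPhysics.QuantumLattice
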